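import Summits.PneNP.PneNP.Theorems.ConstantBand.Negative.LoadBearing
import Summits.PneNP.PneNP.Theorems.SingleThreshold.Negative.Independence
import Summits.PneNP.PneNP.Theorems.SliceACZero.Negative.DeltaBeforeK

/-!
# `SliceTarget` (stmt-PneNP-2832), line `Sketch-ideator3-r1` — stub T1 `SliceTouch`

First moment on ONE Hamming slice for the event "some `k`-clique of `x` has an edge in `F`"
(`Touch n k F x`): for `C(k,2) ≤ j ≤ C(n,2)`,

`#{x ∈ slice_j : Touch_F(x)} ≤ |F| · C(n-2, k-2) · (j / C(n,2))^{C(k,2)} · #slice_j`.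

Union bound over the pairs (edge `e ∈ F`, `k`-set `A` containing both endpoints of `e`): such
`k`-sets number at most `|F| · C(n-2, k-2)` (`card_filter_supset_le`), and for each of them the
slice vectors containing the clique `K_A` number at most `C(N - K, j - K)` (`card_slice_supset_le`),
where `N = C(n,2)`, `K = C(k,2)`; finally `C(N-K, j-K) · N^K ≤ C(N,j) · j^K`
(`choose_sub_mul_pow_le_choose_mul_pow`) and `#slice_j = C(N, j)` (`sliceCard_eq`).
Slice twin of the binomial lemma
`Summit.PneNP.PneNP.Theorems.SingleThreshold.Negative.gnpProb_clique_touching_le`.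
-/

set_option linter.dupNamespace false

namespace Summit.PneNP.PneNP.Cruxes.SliceTarget.Ideator3Line

open Literature.Computability.Complexity Finset Filter Classical
open Summit.PneNP.PneNP.Theorems.ConstantBand.Negative (Edge slice)
open Summit.PneNP.PneNP.Theorems.SingleThreshold.Negative (Edges Touch)
open Summit.PneNP.PneNP.Theorems.SliceACZero.Negative (sliceCard sliceCard_eq card_slice_supset_le
  choose_sub_mul_pow_le_choose_mul_pow supp card_supp supp_injective supp_indicator)

noncomputable section

/-- **The touching `k`-sets are few**: the `k`-subsets of `Fin n` whose clique has an edge in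
`F` number at most `|F| · C(n-2, k-2)` (each contains the two endpoints of some `e ∈ F`).
[folklore] -/
theorem sliceTouch_card_ksets_le (n k : ℕ) (F : Finset (Edge n)) :
    #((powersetCard k (univ : Finset (Fin n))).filter
        fun A => ∃ e ∈ F, cliqueVec A e = true) ≤
      #F * (n - 2).choose (k - 2) := by
  have hTsub : ((powersetCard k (univ : Finset (Fin n))).filter
      fun A => ∃ e ∈ F, cliqueVec A e = true) ⊆
      F.biUnion fun e => (powersetCard k univ).filter fun A => endpts e ⊆ A := by
    intro A hA
    rw [mem_filter] at hA
    obtain ⟨e, he, hce⟩ := hA.2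
    exact mem_biUnion.2
      ⟨e, he, mem_filter.2 ⟨hA.1, (cliqueVec_eq_true_iff_endpts A e).1 hce⟩⟩
  calc _ ≤ #(F.biUnion fun e => (powersetCard k univ).filter fun A => endpts e ⊆ A) :=
        card_le_card hTsub
    _ ≤ ∑ e ∈ F, #((powersetCard k univ).filter fun A => endpts e ⊆ A) := card_biUnion_le
    _ ≤ ∑ e ∈ F, (n - 2).choose (k - 2) := by
        refine sum_le_sum fun e _ => ?_
        have h := card_filter_supset_le (k := k) (endpts e)
        rwa [card_endpts] at h
    _ = #F * (n - 2).choose (k - 2) := by rw [sum_const, smul_eq_mul]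

/-- **Slice count of the touching event** (natural-number form): for `C(k,2) ≤ j`, the vectors of
the slice `j` having a `k`-clique with an edge in `F` number at most
`|F| · C(n-2, k-2) · C(C(n,2) - C(k,2), j - C(k,2))` (union bound over the touching `k`-sets `A`,
and `#{x ∈ slice_j : K_A ⊆ x} ≤ C(N - K, j - K)`). [folklore] -/
theorem sliceTouch_card_nat_le (n k j : ℕ) (F : Finset (Edge n)) (hKj : k.choose 2 ≤ j) :
    #((slice n j).filter fun x => Touch n k F x) ≤
      #F * (n - 2).choose (k - 2) * (n.choose 2 - k.choose 2).choose (j - k.choose 2) := by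
  set T : Finset (Finset (Fin n)) :=
    (powersetCard k univ).filter fun A => ∃ e ∈ F, cliqueVec A e = true with hT
  set G : Finset (Fin n) → Finset (Edge n → Bool) := fun A =>
    univ.filter fun x => edgeCount x = j ∧
      ∀ e ∈ univ.filter (fun e : Edge n => cliqueVec A e = true), x e = true with hG
  have hsub : ((slice n j).filter fun x => Touch n k F x) ⊆ T.biUnion G := by
    intro x hx
    rw [mem_filter] at hx
    obtain ⟨hxj, A, hA, hAx, htouch⟩ := hx
    have hj : edgeCount x = j := (mem_filter.1 hxj).2
    rw [mem_biUnion]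
    refine ⟨A, mem_filter.2 ⟨hA, htouch⟩, ?_⟩
    rw [hG, mem_filter]
    exact ⟨mem_univ _, hj, fun e he => hAx e (mem_filter.1 he).2⟩
  have hGle : ∀ A ∈ T, #(G A) ≤ (n.choose 2 - k.choose 2).choose (j - k.choose 2) := by
    intro A hA
    have hAk : #A = k := (mem_powersetCard.1 (mem_filter.1 hA).1).2
    have hcard : #(univ.filter fun e : Edge n => cliqueVec A e = true) = k.choose 2 := by
      rw [card_filter_cliqueVec, hAk]
    have h := card_slice_supset_le j (univ.filter fun e : Edge n => cliqueVec A e = true)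
      (hcard ▸ hKj)
    rw [hcard] at h
    exact h
  calc _ ≤ #(T.biUnion G) := card_le_card hsub
    _ ≤ ∑ A ∈ T, #(G A) := card_biUnion_le
    _ ≤ ∑ A ∈ T, (n.choose 2 - k.choose 2).choose (j - k.choose 2) := sum_le_sum hGle
    _ = #T * (n.choose 2 - k.choose 2).choose (j - k.choose 2) := by rw [sum_const, smul_eq_mul]
    _ ≤ #F * (n - 2).choose (k - 2) * (n.choose 2 - k.choose 2).choose (j - k.choose 2) :=
        Nat.mul_le_mul_right _ (sliceTouch_card_ksets_le n k F)

/-- **T1 `SliceTouch`** — first moment on the slice for `k`-cliques touching `F`: for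
`C(k,2) ≤ j ≤ C(n,2)`,
`#{x ∈ slice_j : Touch_F(x)} ≤ |F| · C(n-2, k-2) · (j / C(n,2))^{C(k,2)} · #slice_j`
(the natural-number count, the ratio bound `C(N-K, j-K) · N^K ≤ C(N,j) · j^K` and
`#slice_j = C(N,j)`). [folklore] -/
theorem stub_sliceTouch :
    ∀ (n k j : ℕ) (F : Finset (Edge n)), k.choose 2 ≤ j → j ≤ n.choose 2 →
      (#((slice n j).filter fun x => Touch n k F x) : ℝ) ≤
        (#F : ℝ) * ((n - 2).choose (k - 2) : ℝ) * (((j : ℝ) / (n.choose 2 : ℕ)) ^ (k.choose 2)) * #(slice n j) := by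
  intro n k j F hKj hjN
  have hcomb := sliceTouch_card_nat_le n k j F hKj
  have hratio := choose_sub_mul_pow_le_choose_mul_pow (K := k.choose 2) hKj hjN
  -- `N^K > 0`: either `N > 0`, or `N = 0` forces `K = 0`
  have hNK : (0 : ℝ) < ((n.choose 2 : ℕ) : ℝ) ^ (k.choose 2) := by
    rcases Nat.eq_zero_or_pos (n.choose 2) with hN | hN
    · have hK : k.choose 2 = 0 := by omega
      rw [hK, pow_zero]
      exact one_pos
    · exact pow_pos (by exact_mod_cast hN) _
  have hratio' : (((n.choose 2 - k.choose 2).choose (j - k.choose 2) : ℕ) : ℝ) ≤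
      ((n.choose 2).choose j : ℕ) * ((j : ℝ) / (n.choose 2 : ℕ)) ^ (k.choose 2) := by
    rw [div_pow, ← mul_div_assoc, le_div_iff₀ hNK]
    exact_mod_cast hratio
  have hslice : (#(slice n j) : ℝ) = (((n.choose 2).choose j : ℕ) : ℝ) := by
    rw [← sliceCard_eq n j]
    rfl
  calc (#((slice n j).filter fun x => Touch n k F x) : ℝ)
      ≤ (#F : ℝ) * ((n - 2).choose (k - 2) : ℝ) *
          (((n.choose 2 - k.choose 2).choose (j - k.choose 2) : ℕ) : ℝ) := by
        exact_mod_cast hcomb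
    _ ≤ (#F : ℝ) * ((n - 2).choose (k - 2) : ℝ) *
          (((n.choose 2).choose j : ℕ) * ((j : ℝ) / (n.choose 2 : ℕ)) ^ (k.choose 2)) :=
        mul_le_mul_of_nonneg_left hratio' (by positivity)
    _ = (#F : ℝ) * ((n - 2).choose (k - 2) : ℝ) *
          (((j : ℝ) / (n.choose 2 : ℕ)) ^ (k.choose 2)) *
            (((n.choose 2).choose j : ℕ) : ℝ) := by
        ring
    _ = _ := by rw [hslice]

end

end Summit.PneNP.PneNP.Cruxes.SliceTarget.Ideator3Line
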